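import Summits.QuantumFields.YangMills.Theorems.UnitScaleTiltProp7TrueLinDefectBound
import Summits.QuantumFields.YangMills.Theorems.PoincareLipschitzRegaugeAbsorption
import Summits.QuantumFields.YangMills.Theorems.UnitScaleTiltProp7CovIterLambdaBound
import HarnessLib

/-!
# Crux stmt-QuantumFields-19936 `UnitScaleTilt.HistoryTailL`, K2 at depth (route crux `PoincareLipschitz.BlockLipschitzL`, stmt-QuantumFields-23533),
# K2 supplier plan of record (card v1.27 (c), memo `R4-LOCATE-w2g10.md` §3), file F5a — ONE RE-GAUGED (0.4) STEP, POINTWISE: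
# after absorbing the comb-mean gauge, the level ratio of the averages is the comb-transported straight-line mean of the fine ratio
# up to terms that are SECOND ORDER in (loop size `α`, walk mass `m`):
# `‖Y(Ū, (W̄)^g)(c)‖ ≤ ‖LINE_V Y(c)‖ + 159αm + 260m² + 2δ + 8t·(3m + 159αm + 260m² + t)`

Cell `ym3-torus` (YM ladder rung R3 = continuum SU(2) Yang–Mills on the three-torus — a RUNG, NOT the Clay problem: not d = 4, not infinite
volume, not a mass gap); width seat `ym-ust-19936-w2` g10, pen F5 of LEAD `ym-ust-19936-w1` g7's K2 supplier plan (2026-08-29T00:35:51Z).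
Helper `--supports stmt-QuantumFields-19936`; THEOREMS ONLY (0 `def`, 0 `sorry`); rank-, level- and `Params`-generic.  Nothing here proves `hStab`,
a stub, `BlockLipschitzL`, `HistoryTailL` or a summit statement.

THE STEP (memo §3, print's inductive re-gauging [Balaban1985Averaging] §3 (156)–(163)).  Background `V` (level `j`, (0.4) loop variables at `c` within
`α ≤ 1/24` of `1`), competitor `W`, ratio `Y = pertVar V W = W·V* − 1`.  One (0.4) step with the average of record `ℰ = expMeanLogSU`:
* ✓`Prop7HolRatioPerStep.norm_avgFun_ratio_sub_one_sub_trueLin_le` (E1): `Y(V̄, W̄)(c) = T_V Y(c) + R`, `‖R‖ ≤ 260m²`;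
* ✓`Prop7TrueLinReducedStep.norm_reduced_sub_line_le` (E3): `T_V Y(c) = (CM_Y(c₋) − V̄_c·CM_Y(c₊)·V̄_c*) + LINE_V Y(c) + Def`, `‖Def‖ ≤ 159αm`,
  `CM_Y` the covariant comb mean, `LINE_V Y` the comb-transported covariant straight-line mean (both written out below, letter for letter as in E3);
* ✓`PoincareLipschitzRegaugeAbsorption.norm_conj_ratio_sub_linear_le` (F1): re-gauging `W̄` by `g = exp(−ξ)` subtracts the linearised pure gauge
  `ξ(c₋) − V̄_c·ξ(c₊)·V̄_c*` up to `8t(‖Y(V̄,W̄)(c)‖ + t)` when `‖ξ‖ ≤ t ≤ 1` at the two endpoints;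
so for ANY `ξ` within `δ` of `CM_Y` at the two endpoints of `c` the re-gauged ratio is `LINE_V Y(c)` plus the four small terms of the title.  The absorbed
function `ξ` is kept ABSTRACT (the tower file chooses the `𝔰𝔲(2)`-projection of `CM_Y`, so that `exp(−ξ)` is an honest `SU(2)` gauge transformation,
✓`PoincareLipschitzRegaugeAbsorption.exists_gaugeTransf_coe_eq_exp_neg`); only its values at `c₋, c₊` enter.

WHAT IS PROVED (ns `…Theorems.PoincareLipschitzRegaugedStep`; any `Params`, any level `j`, `SU(n)` of any rank).
* §1 `norm_combMean_le`, `norm_line_le_of_mass` — the comb means and the line mean are `≤ m`-type (unitary conjugates by ✓`Prop7CovIterLambdaBound.norm_conj_su_le`).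
* §2 ★★ `norm_pertVar_avgFun_regauged_le` — the title, with the five walk masses of `Y` at `c` (loops, segment, combs at `c₋`, combs at `c₊`,
  translated segments) displayed as `≤ m`; ★ `norm_pertVar_avgFun_regauged_le'` — the same with `t := m + δ`.
* §3 `mass_comb_src_le`, `mass_transSeg_le` (the two walk families not covered by ✓`Prop7TrueLinDefectBound` §2, both `≤ (d+2)L·S(c)`,
  `S(c) = Σ_{blockOf b₋ ∈ {c₋,c₊}}‖Y b‖`), ★★ `norm_pertVar_avgFun_regauged_le_nbhdMass` — the title with every mass discharged by `m := (d+2)L·S(c)`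
  (standing range `j + 1 ≤ m + K`).
HONEST SCOPE.  Bookkeeping over E1/E3/F1 and the triangle inequality; one level, one coarse bond; the choice of `ξ`, the gauge `g`, the tower and every
`ℓ²` sum are the sequel (F5b).  Nothing of [Balaban1985Averaging] is asserted beyond the cited tree theorems.

References: T. Bałaban, CMP 98 (1985) 17–51 [Balaban1985Averaging] (Prop. 3 (122)–(126) p.36, (62)–(63) p.28, §3 (156)–(163)); CMP 109 (1987) 249–301
[Balaban1987RG1] ((0.3)–(0.4) pp.252–253); CMP 102 (1985) 277–309 [Balaban1985Variational] ((15) p.280).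
-/

noncomputable section

open scoped BigOperators Matrix.Norms.L2Operator
open NormedSpace

namespace Summit.QuantumFields.YangMills.Theorems.PoincareLipschitzRegaugedStep

open Literature.MathematicalPhysics.QuantumFieldTheory.Balaban1983to89
open Finset T4Continuum BlockAveraging AveragingRT ExpMeanLog BlockAveragingEMLLinearised BlockAveragingEMLLinearisedBackground BlockAveragingEMLProp2
open Summit.QuantumFields.YangMills.Theorems.Prop7HolRatioPerStep (coe_star_mul_self coe_mul_star_self norm_coe_eq_one norm_star_coe_eq_one
  norm_covWalkSum_le_mass norm_mean_le' norm_avgFun_ratio_sub_one_sub_trueLin_le)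
open Summit.QuantumFields.YangMills.Theorems.Prop7TrueLinReducedStep (norm_reduced_sub_line_le)
open Summit.QuantumFields.YangMills.Theorems.Prop7TrueLinDefectBound (mass_le_length_mul mass_loop_le mass_segment_le mass_comb_tgt_le
  blockOf_src_of_mem_walk_stairWord)
open Summit.QuantumFields.YangMills.Theorems.PoincareLipschitzRegaugeAbsorption (norm_conj_ratio_sub_linear_le star_coe_eq_exp_of_coe_eq_exp_neg)
open Summit.QuantumFields.YangMills.Theorems.Prop7CovIterLambdaBound (norm_conj_su_le)

variable {P : Params} {n : Type*} [Fintype n] [DecidableEq n] [Nonempty n] {j : ℕ}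

/-! ## §1 Sizes of the comb means, the line mean and the reduced linearisation -/

/-- **The covariant comb mean at a coarse site is bounded by the comb masses**: `‖CM_Y(y)‖ ≤ m`. [cite: Balaban1985Averaging, (62) p.28] -/
theorem norm_combMean_le (V : GaugeField P j (Matrix.specialUnitaryGroup n ℂ)) (Y : PBond P j → Matrix n n ℂ) (y : Site P (j + 1)) {m : ℝ}
    (hmC : ∀ (σ : Equiv.Perm (Fin P.d)) (r : Fin P.d → Fin P.L), ((walk (emb y) (stairWord σ (off r))).map fun s => ‖Y s.bond‖).sum ≤ m) :
    ‖((Fintype.card (Idx P) : ℂ))⁻¹ • ∑ i : Idx P, covWalkSum V Y (walk (emb y) (stairWord i.2.1 (off i.1)))‖ ≤ m :=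
  norm_mean_le' fun i => (norm_covWalkSum_le_mass V Y _).trans (hmC i.2.1 i.1)

/-- **The comb-transported straight-line mean is bounded by the translated-segment masses**: `‖LINE_V Y(c)‖ ≤ m`.
[cite: Balaban1985Averaging, Prop. 3 (125) p.36] -/
theorem norm_line_le_of_mass (V : GaugeField P j (Matrix.specialUnitaryGroup n ℂ)) (Y : PBond P j → Matrix n n ℂ) (c : PBond P (j + 1)) {m : ℝ}
    (hmSi : ∀ i : Idx P, ((walk (walkEnd (emb c.src) (stairWord i.2.1 (off i.1))) (List.replicate P.L (c.dir, true))).map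
      fun s => ‖Y s.bond‖).sum ≤ m) :
    ‖((Fintype.card (Idx P) : ℂ))⁻¹ • ∑ i : Idx P,
        ((holAt V (walk (emb c.src) (stairWord i.2.1 (off i.1))) : Matrix.specialUnitaryGroup n ℂ) : Matrix n n ℂ) *
          covWalkSum V Y (walk (walkEnd (emb c.src) (stairWord i.2.1 (off i.1))) (List.replicate P.L (c.dir, true))) *
        star ((holAt V (walk (emb c.src) (stairWord i.2.1 (off i.1))) : Matrix.specialUnitaryGroup n ℂ) : Matrix n n ℂ)‖ ≤ m :=
  norm_mean_le' fun i => (norm_conj_su_le _ _).trans ((norm_covWalkSum_le_mass V Y _).trans (hmSi i))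

/-! ## §2 The re-gauged step at a coarse bond -/

/-- ★★ **ONE RE-GAUGED (0.4) STEP, POINTWISE.**  `V, W` level-`j` `SU(n)` fields, `Y = pertVar V W`; background loop variables at `c` within `α ≤ 1/24` of `1`;
the walk masses of `Y` along the (0.4) loops at `c`, the segment `[y, y′]`, the combs at `c₋` and at `c₊`, and the translated segments `[x_i, x_i′]` all `≤ m`,
`72m ≤ 1`, `3m + α < δ_n`; `ξ₋, ξ₊` matrices with `‖ξ∓ − CM_Y(c∓)‖ ≤ δ` and `‖ξ∓‖ ≤ t ≤ 1`; `g` a level-`(j+1)` gauge transformation with `↑(g c₋) = exp(−ξ₋)`,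
`↑(g c₊) = exp(−ξ₊)`.  Then
`‖pertVar (avgFun ℰ V) (gaugeAct g (avgFun ℰ W)) c‖ ≤ ‖LINE_V Y(c)‖ + 159αm + 260m² + 2δ + 8t(3m + 159αm + 260m² + t)`, `ℰ = expMeanLogSU`.
[cite: Balaban1985Averaging, Prop. 3 (122)-(126) p.36] -/
theorem norm_pertVar_avgFun_regauged_le (V W : GaugeField P j (Matrix.specialUnitaryGroup n ℂ)) (c : PBond P (j + 1)) {m α δ t : ℝ}
    (hmL : ∀ i : Idx P, ((walk (emb c.src) (loopWord P.L c.dir (off i.1) i.2.1 i.2.2)).map fun s => ‖pertVar V W s.bond‖).sum ≤ m)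
    (hmS : ((walk (emb c.src) (List.replicate P.L (c.dir, true))).map fun s => ‖pertVar V W s.bond‖).sum ≤ m)
    (hmC0 : ∀ (σ : Equiv.Perm (Fin P.d)) (r : Fin P.d → Fin P.L),
      ((walk (emb c.src) (stairWord σ (off r))).map fun s => ‖pertVar V W s.bond‖).sum ≤ m)
    (hmC : ∀ (σ : Equiv.Perm (Fin P.d)) (r : Fin P.d → Fin P.L),
      ((walk (emb c.tgt) (stairWord σ (off r))).map fun s => ‖pertVar V W s.bond‖).sum ≤ m)
    (hmSi : ∀ i : Idx P, ((walk (walkEnd (emb c.src) (stairWord i.2.1 (off i.1))) (List.replicate P.L (c.dir, true))).map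
      fun s => ‖pertVar V W s.bond‖).sum ≤ m)
    (hm72 : 72 * m ≤ 1) (hα : ∀ i, dist1 (loopHol V c i) ≤ α) (hα24 : α ≤ 1 / 24) (hN : 3 * m + α < deltaSU n)
    {ξm ξp : Matrix n n ℂ}
    (hδm : ‖ξm - ((Fintype.card (Idx P) : ℂ))⁻¹ • ∑ i : Idx P, covWalkSum V (pertVar V W) (walk (emb c.src) (stairWord i.2.1 (off i.1)))‖ ≤ δ)
    (hδp : ‖ξp - ((Fintype.card (Idx P) : ℂ))⁻¹ • ∑ i : Idx P, covWalkSum V (pertVar V W) (walk (emb c.tgt) (stairWord i.2.1 (off i.1)))‖ ≤ δ)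
    (htm : ‖ξm‖ ≤ t) (htp : ‖ξp‖ ≤ t) (ht : t ≤ 1)
    (g : GaugeTransf P (j + 1) (Matrix.specialUnitaryGroup n ℂ))
    (hgm : ((g c.src : Matrix.specialUnitaryGroup n ℂ) : Matrix n n ℂ) = exp (-ξm))
    (hgp : ((g c.tgt : Matrix.specialUnitaryGroup n ℂ) : Matrix n n ℂ) = exp (-ξp)) :
    ‖pertVar (avgFun (expMeanLogSU (n := n)) V) (GaugeField.gaugeAct g (avgFun (expMeanLogSU (n := n)) W)) c‖ ≤
      ‖((Fintype.card (Idx P) : ℂ))⁻¹ • ∑ i : Idx P,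
          ((holAt V (walk (emb c.src) (stairWord i.2.1 (off i.1))) : Matrix.specialUnitaryGroup n ℂ) : Matrix n n ℂ) *
            covWalkSum V (pertVar V W) (walk (walkEnd (emb c.src) (stairWord i.2.1 (off i.1))) (List.replicate P.L (c.dir, true))) *
          star ((holAt V (walk (emb c.src) (stairWord i.2.1 (off i.1))) : Matrix.specialUnitaryGroup n ℂ) : Matrix n n ℂ)‖
        + 159 * α * m + 260 * m ^ 2 + 2 * δ + 8 * t * (3 * m + 159 * α * m + 260 * m ^ 2 + t) := by
  -- positivity letters
  have hm0 : 0 ≤ m := (List.sum_nonneg fun y hy => by obtain ⟨z, _, rfl⟩ := List.mem_map.mp hy; exact norm_nonneg _).trans hmS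
  have hα0 : 0 ≤ α := (GaugeGroup.dist1_nonneg _).trans (hα (Classical.arbitrary _))
  have ht0 : 0 ≤ t := (norm_nonneg _).trans htm
  have hδ0 : 0 ≤ δ := (norm_nonneg _).trans hδm
  have hαN : α < deltaSU n := by linarith
  -- abbreviations
  set Y : PBond P j → Matrix n n ℂ := pertVar V W with hYdef
  set Vb : Matrix n n ℂ := ((avgFun (expMeanLogSU (n := n)) V c : Matrix.specialUnitaryGroup n ℂ) : Matrix n n ℂ) with hVb
  set Wb : Matrix n n ℂ := ((avgFun (expMeanLogSU (n := n)) W c : Matrix.specialUnitaryGroup n ℂ) : Matrix n n ℂ) with hWb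
  set T : Matrix n n ℂ := fderiv ℂ (eml : (Idx P → Matrix n n ℂ) → Matrix n n ℂ)
        (fun i => ((loopHol V c i : Matrix.specialUnitaryGroup n ℂ) : Matrix n n ℂ))
          (fun i => covWalkSum V Y (walk (emb c.src) (loopWord P.L c.dir (off i.1) i.2.1 i.2.2))
            * ((loopHol V c i : Matrix.specialUnitaryGroup n ℂ) : Matrix n n ℂ))
          * star ((corr (expMeanLogSU (n := n)) V c : Matrix.specialUnitaryGroup n ℂ) : Matrix n n ℂ)
        + ((corr (expMeanLogSU (n := n)) V c : Matrix.specialUnitaryGroup n ℂ) : Matrix n n ℂ)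
          * covWalkSum V Y (walk (emb c.src) (List.replicate P.L (c.dir, true)))
          * star ((corr (expMeanLogSU (n := n)) V c : Matrix.specialUnitaryGroup n ℂ) : Matrix n n ℂ) with hT
  set CMm : Matrix n n ℂ := ((Fintype.card (Idx P) : ℂ))⁻¹ • ∑ i : Idx P, covWalkSum V Y (walk (emb c.src) (stairWord i.2.1 (off i.1)))
    with hCMm
  set CMp : Matrix n n ℂ := ((Fintype.card (Idx P) : ℂ))⁻¹ • ∑ i : Idx P, covWalkSum V Y (walk (emb c.tgt) (stairWord i.2.1 (off i.1)))
    with hCMp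
  set LINE : Matrix n n ℂ := ((Fintype.card (Idx P) : ℂ))⁻¹ • ∑ i : Idx P,
        ((holAt V (walk (emb c.src) (stairWord i.2.1 (off i.1))) : Matrix.specialUnitaryGroup n ℂ) : Matrix n n ℂ) *
          covWalkSum V Y (walk (walkEnd (emb c.src) (stairWord i.2.1 (off i.1))) (List.replicate P.L (c.dir, true))) *
        star ((holAt V (walk (emb c.src) (stairWord i.2.1 (off i.1))) : Matrix.specialUnitaryGroup n ℂ) : Matrix n n ℂ) with hLINE
  -- the pre-ratio `Y(V̄, W̄)(c) = W̄_c V̄_c* − 1`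
  set Ypre : Matrix n n ℂ := Wb * star Vb - 1 with hYpre
  -- E1: the one-step true linearisation with remainder `260m²`
  have hE1 : ‖Ypre - T‖ ≤ 260 * m ^ 2 := by
    have h := norm_avgFun_ratio_sub_one_sub_trueLin_le V W c hmL hmS hm72 hα hα24 hN
    simpa only [hYpre, hT, hVb, hWb, hYdef] using h
  -- E3: the reduced split `T = (CM₋ − V̄ CM₊ V̄*) + LINE + Def`, `‖Def‖ ≤ 159αm`
  have hE3 : ‖T - (CMm - Vb * CMp * star Vb) - LINE‖ ≤ 159 * α * m := by
    have h := norm_reduced_sub_line_le V Y c hmL hmS hmC hα hα24 hαN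
    simpa only [hT, hCMm, hCMp, hLINE, hVb] using h
  -- sizes of the pieces
  have hCMm_le : ‖CMm‖ ≤ m := norm_combMean_le V Y c.src hmC0
  have hCMp_le : ‖CMp‖ ≤ m := norm_combMean_le V Y c.tgt hmC
  have hLINE_le : ‖LINE‖ ≤ m := norm_line_le_of_mass V Y c hmSi
  have hPCM_le : ‖CMm - Vb * CMp * star Vb‖ ≤ 2 * m := by
    calc _ ≤ ‖CMm‖ + ‖Vb * CMp * star Vb‖ := norm_sub_le _ _
      _ ≤ m + m := add_le_add hCMm_le ((norm_conj_su_le _ _).trans hCMp_le)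
      _ = 2 * m := by ring
  have hT_le : ‖T‖ ≤ 3 * m + 159 * α * m := by
    have e : T = (T - (CMm - Vb * CMp * star Vb) - LINE) + (CMm - Vb * CMp * star Vb) + LINE := by abel
    rw [e]
    calc _ ≤ ‖T - (CMm - Vb * CMp * star Vb) - LINE‖ + ‖CMm - Vb * CMp * star Vb‖ + ‖LINE‖ := norm_add₃_le
      _ ≤ 159 * α * m + 2 * m + m := add_le_add (add_le_add hE3 hPCM_le) hLINE_le
      _ = 3 * m + 159 * α * m := by ring
  have hYpre_le : ‖Ypre‖ ≤ 3 * m + 159 * α * m + 260 * m ^ 2 := by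
    have e : Ypre = (Ypre - T) + T := by abel
    rw [e]
    exact (norm_add_le _ _).trans (by linarith [hE1, hT_le])
  -- F1: the absorption at the two endpoints (the pair `Vb, Wb` of unitary matrices)
  have hF1 : ‖exp (-ξm) * Wb * exp ξp * star Vb - 1 - ((Wb * star Vb - 1) - (ξm - Vb * ξp * star Vb))‖ ≤ 8 * t * (‖Wb * star Vb - 1‖ + t) :=
    norm_conj_ratio_sub_linear_le (coe_mul_star_self _) (coe_star_mul_self _) (norm_coe_eq_one _).le (norm_star_coe_eq_one _).le htm htp ht
  -- the re-gauged ratio written out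
  have hlhs : pertVar (avgFun (expMeanLogSU (n := n)) V) (GaugeField.gaugeAct g (avgFun (expMeanLogSU (n := n)) W)) c =
      exp (-ξm) * Wb * exp ξp * star Vb - 1 := by
    rw [pertVar_eq]
    unfold GaugeField.gaugeAct
    rw [Submonoid.coe_mul, Submonoid.coe_mul,
      show (((g c.tgt)⁻¹ : Matrix.specialUnitaryGroup n ℂ) : Matrix n n ℂ) = star ((g c.tgt : Matrix.specialUnitaryGroup n ℂ) : Matrix n n ℂ)
        from rfl, hgm, star_coe_eq_exp_of_coe_eq_exp_neg hgp]
  rw [hlhs]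
  -- the gauge mismatch `(CM₋ − V̄ CM₊ V̄*) − (ξ₋ − V̄ ξ₊ V̄*)` is `≤ 2δ`
  have hmis : ‖(CMm - Vb * CMp * star Vb) - (ξm - Vb * ξp * star Vb)‖ ≤ 2 * δ := by
    have e : (CMm - Vb * CMp * star Vb) - (ξm - Vb * ξp * star Vb) = -(ξm - CMm) + Vb * (ξp - CMp) * star Vb := by noncomm_ring
    rw [e]
    calc _ ≤ ‖-(ξm - CMm)‖ + ‖Vb * (ξp - CMp) * star Vb‖ := norm_add_le _ _
      _ ≤ δ + δ := add_le_add (by rw [norm_neg]; exact hδm) ((norm_conj_su_le _ _).trans hδp)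
      _ = 2 * δ := by ring
  -- assemble: `new = [new − (Ypre − Pξ)] + (Ypre − T) + (T − PCM − LINE) + LINE + (PCM − Pξ)`
  have e : exp (-ξm) * Wb * exp ξp * star Vb - 1 =
      (exp (-ξm) * Wb * exp ξp * star Vb - 1 - ((Wb * star Vb - 1) - (ξm - Vb * ξp * star Vb)))
        + (Ypre - T) + (T - (CMm - Vb * CMp * star Vb) - LINE) + LINE + ((CMm - Vb * CMp * star Vb) - (ξm - Vb * ξp * star Vb)) := by
    rw [hYpre]; abel
  rw [e]
  have h8 : 8 * t * (‖Wb * star Vb - 1‖ + t) ≤ 8 * t * (3 * m + 159 * α * m + 260 * m ^ 2 + t) := by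
    have : ‖Wb * star Vb - 1‖ ≤ 3 * m + 159 * α * m + 260 * m ^ 2 := hYpre_le
    have h8t : 0 ≤ 8 * t := by positivity
    exact mul_le_mul_of_nonneg_left (by linarith) h8t
  calc _ ≤ ‖exp (-ξm) * Wb * exp ξp * star Vb - 1 - ((Wb * star Vb - 1) - (ξm - Vb * ξp * star Vb))‖
          + ‖Ypre - T‖ + ‖T - (CMm - Vb * CMp * star Vb) - LINE‖ + ‖LINE‖ + ‖(CMm - Vb * CMp * star Vb) - (ξm - Vb * ξp * star Vb)‖ :=
        norm_add_le_of_le (norm_add_le_of_le (norm_add_le_of_le (norm_add_le_of_le le_rfl le_rfl) le_rfl) le_rfl) le_rfl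
    _ ≤ 8 * t * (3 * m + 159 * α * m + 260 * m ^ 2 + t) + 260 * m ^ 2 + 159 * α * m + ‖LINE‖ + 2 * δ :=
        add_le_add (add_le_add (add_le_add (add_le_add (hF1.trans h8) hE1) hE3) le_rfl) hmis
    _ = ‖LINE‖ + 159 * α * m + 260 * m ^ 2 + 2 * δ + 8 * t * (3 * m + 159 * α * m + 260 * m ^ 2 + t) := by ring

/-- ★ **The same with `t := m + δ`** (`‖ξ∓‖ ≤ ‖CM_Y(c∓)‖ + δ ≤ m + δ`), for `m + δ ≤ 1`. [cite: Balaban1985Averaging, Prop. 3 (122)-(126) p.36] -/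
theorem norm_pertVar_avgFun_regauged_le' (V W : GaugeField P j (Matrix.specialUnitaryGroup n ℂ)) (c : PBond P (j + 1)) {m α δ : ℝ}
    (hmL : ∀ i : Idx P, ((walk (emb c.src) (loopWord P.L c.dir (off i.1) i.2.1 i.2.2)).map fun s => ‖pertVar V W s.bond‖).sum ≤ m)
    (hmS : ((walk (emb c.src) (List.replicate P.L (c.dir, true))).map fun s => ‖pertVar V W s.bond‖).sum ≤ m)
    (hmC0 : ∀ (σ : Equiv.Perm (Fin P.d)) (r : Fin P.d → Fin P.L),
      ((walk (emb c.src) (stairWord σ (off r))).map fun s => ‖pertVar V W s.bond‖).sum ≤ m)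
    (hmC : ∀ (σ : Equiv.Perm (Fin P.d)) (r : Fin P.d → Fin P.L),
      ((walk (emb c.tgt) (stairWord σ (off r))).map fun s => ‖pertVar V W s.bond‖).sum ≤ m)
    (hmSi : ∀ i : Idx P, ((walk (walkEnd (emb c.src) (stairWord i.2.1 (off i.1))) (List.replicate P.L (c.dir, true))).map
      fun s => ‖pertVar V W s.bond‖).sum ≤ m)
    (hm72 : 72 * m ≤ 1) (hα : ∀ i, dist1 (loopHol V c i) ≤ α) (hα24 : α ≤ 1 / 24) (hN : 3 * m + α < deltaSU n)
    {ξm ξp : Matrix n n ℂ}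
    (hδm : ‖ξm - ((Fintype.card (Idx P) : ℂ))⁻¹ • ∑ i : Idx P, covWalkSum V (pertVar V W) (walk (emb c.src) (stairWord i.2.1 (off i.1)))‖ ≤ δ)
    (hδp : ‖ξp - ((Fintype.card (Idx P) : ℂ))⁻¹ • ∑ i : Idx P, covWalkSum V (pertVar V W) (walk (emb c.tgt) (stairWord i.2.1 (off i.1)))‖ ≤ δ)
    (hmδ : m + δ ≤ 1)
    (g : GaugeTransf P (j + 1) (Matrix.specialUnitaryGroup n ℂ))
    (hgm : ((g c.src : Matrix.specialUnitaryGroup n ℂ) : Matrix n n ℂ) = exp (-ξm))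
    (hgp : ((g c.tgt : Matrix.specialUnitaryGroup n ℂ) : Matrix n n ℂ) = exp (-ξp)) :
    ‖pertVar (avgFun (expMeanLogSU (n := n)) V) (GaugeField.gaugeAct g (avgFun (expMeanLogSU (n := n)) W)) c‖ ≤
      ‖((Fintype.card (Idx P) : ℂ))⁻¹ • ∑ i : Idx P,
          ((holAt V (walk (emb c.src) (stairWord i.2.1 (off i.1))) : Matrix.specialUnitaryGroup n ℂ) : Matrix n n ℂ) *
            covWalkSum V (pertVar V W) (walk (walkEnd (emb c.src) (stairWord i.2.1 (off i.1))) (List.replicate P.L (c.dir, true))) *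
          star ((holAt V (walk (emb c.src) (stairWord i.2.1 (off i.1))) : Matrix.specialUnitaryGroup n ℂ) : Matrix n n ℂ)‖
        + 159 * α * m + 260 * m ^ 2 + 2 * δ + 8 * (m + δ) * (3 * m + 159 * α * m + 260 * m ^ 2 + (m + δ)) := by
  have htm : ‖ξm‖ ≤ m + δ := by
    have := norm_le_insert' ξm (((Fintype.card (Idx P) : ℂ))⁻¹ • ∑ i : Idx P,
      covWalkSum V (pertVar V W) (walk (emb c.src) (stairWord i.2.1 (off i.1))))
    linarith [norm_combMean_le V (pertVar V W) c.src hmC0]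
  have htp : ‖ξp‖ ≤ m + δ := by
    have := norm_le_insert' ξp (((Fintype.card (Idx P) : ℂ))⁻¹ • ∑ i : Idx P,
      covWalkSum V (pertVar V W) (walk (emb c.tgt) (stairWord i.2.1 (off i.1))))
    linarith [norm_combMean_le V (pertVar V W) c.tgt hmC]
  exact norm_pertVar_avgFun_regauged_le V W c hmL hmS hmC0 hmC hmSi hm72 hα hα24 hN hδm hδp htm htp hmδ g hgm hgp

/-! ## §3 Every walk mass at `c` against the two-block neighbourhood mass `S(c)` (standing range) -/

omit [Nonempty n] in
/-- The combs at `c₋` have mass `≤ (d+2)L·S(c)` (twin of ✓`mass_comb_tgt_le`). [cite: Balaban1987RG1, (0.3) p.252] -/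
theorem mass_comb_src_le (hj : j + 1 ≤ P.m + P.K) (Z : PBond P j → Matrix n n ℂ) (c : PBond P (j + 1)) (σ : Equiv.Perm (Fin P.d))
    (r : Fin P.d → Fin P.L) :
    ((walk (emb c.src) (stairWord σ (off r))).map fun s => ‖Z s.bond‖).sum
      ≤ (((P.d + 2) * P.L : ℕ) : ℝ) * ∑ b ∈ univ.filter (fun b : PBond P j => blockOf b.src = c.src ∨ blockOf b.src = c.tgt), ‖Z b‖ := by
  have hmem : ∀ s ∈ walk (emb c.src) (stairWord σ (off r)),
      s.bond ∈ univ.filter (fun b : PBond P j => blockOf b.src = c.src ∨ blockOf b.src = c.tgt) :=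
    fun s hs => Finset.mem_filter.2 ⟨Finset.mem_univ _, Or.inl (blockOf_src_of_mem_walk_stairWord hj c.src σ r s hs)⟩
  refine (mass_le_length_mul Z _ _ hmem).trans (mul_le_mul_of_nonneg_right ?_ (Finset.sum_nonneg fun b _ => norm_nonneg _))
  exact_mod_cast length_walk_stairWord_le (emb c.src) σ r

omit [Nonempty n] in
/-- The translated segments `[x_i, x_i′]` (the middle run of the i-th (0.4) loop) have mass `≤ (d+2)L·S(c)`. [cite: Balaban1987RG1, (0.4) p.253] -/
theorem mass_transSeg_le (hj : j + 1 ≤ P.m + P.K) (Z : PBond P j → Matrix n n ℂ) (c : PBond P (j + 1)) (i : Idx P) :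
    ((walk (walkEnd (emb c.src) (stairWord i.2.1 (off i.1))) (List.replicate P.L (c.dir, true))).map fun s => ‖Z s.bond‖).sum
      ≤ (((P.d + 2) * P.L : ℕ) : ℝ) * ∑ b ∈ univ.filter (fun b : PBond P j => blockOf b.src = c.src ∨ blockOf b.src = c.tgt), ‖Z b‖ := by
  -- the translated segment is a sub-walk of the i-th loop walk
  have hsub : ∀ s ∈ walk (walkEnd (emb c.src) (stairWord i.2.1 (off i.1))) (List.replicate P.L (c.dir, true)),
      s ∈ walk (emb c.src) (loopWord P.L c.dir (off i.1) i.2.1 i.2.2) := by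
    intro s hs
    unfold loopWord
    rw [walk_append, walk_append]
    exact List.mem_append_right _ (List.mem_append_left _ hs)
  have hmem : ∀ s ∈ walk (walkEnd (emb c.src) (stairWord i.2.1 (off i.1))) (List.replicate P.L (c.dir, true)),
      s.bond ∈ univ.filter (fun b : PBond P j => blockOf b.src = c.src ∨ blockOf b.src = c.tgt) :=
    fun s hs => Finset.mem_filter.2 ⟨Finset.mem_univ _, blockOf_src_of_mem_walk hj c i s (hsub s hs)⟩
  refine (mass_le_length_mul Z _ _ hmem).trans (mul_le_mul_of_nonneg_right ?_ (Finset.sum_nonneg fun b _ => norm_nonneg _))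
  have hlen : (walk (walkEnd (emb c.src) (stairWord i.2.1 (off i.1))) (List.replicate P.L (c.dir, true))).length = P.L := by
    rw [length_walk, List.length_replicate]
  rw [hlen]
  push_cast
  nlinarith [Nat.cast_nonneg (α := ℝ) P.d, Nat.cast_nonneg (α := ℝ) P.L]

/-- ★★ **THE RE-GAUGED STEP WITH THE MASSES DISCHARGED IN THE TWO-BLOCK NEIGHBOURHOOD** (standing range `j + 1 ≤ m + K`): with
`S(c) = Σ_{blockOf b₋ ∈ {c₋, c₊}} ‖Y b‖` and `m := (d+2)L·S(c)`, `72m ≤ 1`, `3m + α < δ_n`, `m + δ ≤ 1`, `‖ξ∓ − CM_Y(c∓)‖ ≤ δ`: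
`‖Y(V̄, W̄^g)(c)‖ ≤ ‖LINE_V Y(c)‖ + 159αm + 260m² + 2δ + 8(m+δ)(3m + 159αm + 260m² + m + δ)`. [cite: Balaban1985Averaging, Prop. 3 (122)-(126) p.36] -/
theorem norm_pertVar_avgFun_regauged_le_nbhdMass (hj : j + 1 ≤ P.m + P.K) (V W : GaugeField P j (Matrix.specialUnitaryGroup n ℂ))
    (c : PBond P (j + 1)) {α δ : ℝ}
    (hm72 : 72 * ((((P.d + 2) * P.L : ℕ) : ℝ) *
      ∑ b ∈ univ.filter (fun b : PBond P j => blockOf b.src = c.src ∨ blockOf b.src = c.tgt), ‖pertVar V W b‖) ≤ 1)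
    (hα : ∀ i, dist1 (loopHol V c i) ≤ α) (hα24 : α ≤ 1 / 24)
    (hN : 3 * ((((P.d + 2) * P.L : ℕ) : ℝ) *
      ∑ b ∈ univ.filter (fun b : PBond P j => blockOf b.src = c.src ∨ blockOf b.src = c.tgt), ‖pertVar V W b‖) + α < deltaSU n)
    {ξm ξp : Matrix n n ℂ}
    (hδm : ‖ξm - ((Fintype.card (Idx P) : ℂ))⁻¹ • ∑ i : Idx P, covWalkSum V (pertVar V W) (walk (emb c.src) (stairWord i.2.1 (off i.1)))‖ ≤ δ)
    (hδp : ‖ξp - ((Fintype.card (Idx P) : ℂ))⁻¹ • ∑ i : Idx P, covWalkSum V (pertVar V W) (walk (emb c.tgt) (stairWord i.2.1 (off i.1)))‖ ≤ δ)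
    (hmδ : (((P.d + 2) * P.L : ℕ) : ℝ) *
      ∑ b ∈ univ.filter (fun b : PBond P j => blockOf b.src = c.src ∨ blockOf b.src = c.tgt), ‖pertVar V W b‖ + δ ≤ 1)
    (g : GaugeTransf P (j + 1) (Matrix.specialUnitaryGroup n ℂ))
    (hgm : ((g c.src : Matrix.specialUnitaryGroup n ℂ) : Matrix n n ℂ) = exp (-ξm))
    (hgp : ((g c.tgt : Matrix.specialUnitaryGroup n ℂ) : Matrix n n ℂ) = exp (-ξp)) :
    ‖pertVar (avgFun (expMeanLogSU (n := n)) V) (GaugeField.gaugeAct g (avgFun (expMeanLogSU (n := n)) W)) c‖ ≤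
      ‖((Fintype.card (Idx P) : ℂ))⁻¹ • ∑ i : Idx P,
          ((holAt V (walk (emb c.src) (stairWord i.2.1 (off i.1))) : Matrix.specialUnitaryGroup n ℂ) : Matrix n n ℂ) *
            covWalkSum V (pertVar V W) (walk (walkEnd (emb c.src) (stairWord i.2.1 (off i.1))) (List.replicate P.L (c.dir, true))) *
          star ((holAt V (walk (emb c.src) (stairWord i.2.1 (off i.1))) : Matrix.specialUnitaryGroup n ℂ) : Matrix n n ℂ)‖
        + 159 * α * ((((P.d + 2) * P.L : ℕ) : ℝ) *
            ∑ b ∈ univ.filter (fun b : PBond P j => blockOf b.src = c.src ∨ blockOf b.src = c.tgt), ‖pertVar V W b‖)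
        + 260 * ((((P.d + 2) * P.L : ℕ) : ℝ) *
            ∑ b ∈ univ.filter (fun b : PBond P j => blockOf b.src = c.src ∨ blockOf b.src = c.tgt), ‖pertVar V W b‖) ^ 2
        + 2 * δ
        + 8 * ((((P.d + 2) * P.L : ℕ) : ℝ) *
              ∑ b ∈ univ.filter (fun b : PBond P j => blockOf b.src = c.src ∨ blockOf b.src = c.tgt), ‖pertVar V W b‖ + δ) *
          (3 * ((((P.d + 2) * P.L : ℕ) : ℝ) *
              ∑ b ∈ univ.filter (fun b : PBond P j => blockOf b.src = c.src ∨ blockOf b.src = c.tgt), ‖pertVar V W b‖)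
            + 159 * α * ((((P.d + 2) * P.L : ℕ) : ℝ) *
              ∑ b ∈ univ.filter (fun b : PBond P j => blockOf b.src = c.src ∨ blockOf b.src = c.tgt), ‖pertVar V W b‖)
            + 260 * ((((P.d + 2) * P.L : ℕ) : ℝ) *
              ∑ b ∈ univ.filter (fun b : PBond P j => blockOf b.src = c.src ∨ blockOf b.src = c.tgt), ‖pertVar V W b‖) ^ 2
            + ((((P.d + 2) * P.L : ℕ) : ℝ) *
              ∑ b ∈ univ.filter (fun b : PBond P j => blockOf b.src = c.src ∨ blockOf b.src = c.tgt), ‖pertVar V W b‖ + δ)) :=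
  norm_pertVar_avgFun_regauged_le' V W c
    (fun i => mass_loop_le hj _ c i) (mass_segment_le hj _ c) (fun σ r => mass_comb_src_le hj _ c σ r)
    (fun σ r => mass_comb_tgt_le hj _ c σ r) (fun i => mass_transSeg_le hj _ c i) hm72 hα hα24 hN hδm hδp hmδ g hgm hgp

end Summit.QuantumFields.YangMills.Theorems.PoincareLipschitzRegaugedStep

end
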